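import Summits.AtomisticToContinuum.Crystallization.Theses.DisclinationRation
import Summits.AtomisticToContinuum.Crystallization.Theorems.HullExactificationCascadeHullBulkOptimal
import Summits.AtomisticToContinuum.Crystallization.Theorems.HullExactificationCascadeHullDefectDensityZero
import Summits.AtomisticToContinuum.Crystallization.Theorems.ExcessDecayLiouvilleCrysEnergyLimit
import Summits.AtomisticToContinuum.Crystallization.Theorems.DisclinationRationBarlowLiouvilleStubTransfer
import Summits.AtomisticToContinuum.Crystallization.Theorems.DisclinationRationBarlowLiouvilleStubUniformSpacing
import Summits.AtomisticToContinuum.Crystallization.Theorems.DisclinationRationBarlowLiouvilleStubPriceTransfer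
import Summits.AtomisticToContinuum.Crystallization.Theorems.DisclinationRationBarlowLiouvilleSlack
import Summits.AtomisticToContinuum.Crystallization.Theorems.DisclinationRationBarlowLiouvilleStubCellsToPatches
import Summits.AtomisticToContinuum.Crystallization.Theorems.DisclinationRationBarlowLiouvilleStubPigeonhole
import Summits.AtomisticToContinuum.Crystallization.Theorems.DisclinationRationBarlowLiouvilleCertificateGlue
import Summits.AtomisticToContinuum.Crystallization.Theorems.DisclinationRationBarlowLiouvilleStubFluxBookkeeping

/-!
# Skeleton — crux `BarlowLiouville` (item `stmt-AtomisticToContinuum-15801`), line `Sketch` (= `birth`)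

Route `route-AtomisticToContinuum-DisclinationRation` (crux K3, rank 6). Leads:
prover-line-stmt-AtomisticToContinuum-15801-0 (revs 1–4b), prover-line-stmt-AtomisticToContinuum-15801-c1-0 (rev 5:
the landed `stub_pigeonhole` IMPORTED; rev 6: the kernel `stub_priceSlack` DERIVED from a SITEWISE CERTIFICATE WITH
ANTISYMMETRIC r⁻⁶-DOMINATED TRANSFER `stub_siteCertificate` (XL, the lead's) + the boundary-flux bookkeeping
`stub_fluxBookkeeping` (M, LANDED p172925) via the landed glue `priceSlack_of_certificate_flux` (p172614) — rev 6b: ONE sorry =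
`stub_siteCertificate`). Built on the registered birth skeleton
`Cruxes/BarlowLiouville/Lines/birth.lean` (patches → one spacing → windows), restated DEF-FREE (every stub
signature is written in the crux's own vocabulary with inlined `let`s, so that each stub lands as a
pure-proof file under `Theorems/` and the compositions are by definitional unfolding only), and with the
load-bearing `stub_patches` RESHAPED (rev 2) into the density chain price → density → pigeonhole, and (rev 3) the
price kernel cut at CELL SCALE: `stub_price` ⇐ `stub_price2` (kernel at radius 2) + exact local rigidity of the
layered family (`stub_exactLocalRigidity`) + compactness (`stub_rigidityCompactness`) + bookkeeping
(`stub_priceTransfer`); and (rev 4) the kernel WEAKENED by a mesoscopic slack `θ·#(X ∩ B̄_L)` in the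
`∃ c ∀ θ ∃ C` shape of the sibling engine interface `PrestressSplitKorn.SplitCoercivity` (crux 13603, stub S4),
the geometry supplied by the LANDED global exact rigidity `PrestressSplitKorn.exactLayeredRigidity_holds` through
one compactness stub `stub_cellsToPatches`:

The crux (verbatim decl `Summit.AtomisticToContinuum.Crystallization.Theses.DisclinationRation.BarlowLiouville`):
given `UniformPolytypeStability` (K4), for every sequence `x` of Lennard-Jones ground states in `ℝ³`,
every `δ`-separated, relatively dense hull element `X` of `x` all of whose points are
`1/20`-{fcc,hcp}-good and which is Barlow-templated yields LAYERED WINDOWS OF `x` AT EVERY SCALE.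

Registered stubs:
* `stub_price` (XL, load-bearing, the lead's) — the TUBE PRICE INEQUALITY: for a `δ`-separated,
  relatively dense, everywhere-good, templated `X` and every `(R, η)` there are `c > 0`, `C` with
  `c · #{y ∈ X ∩ B̄_L(ctr) : the R-ball of X about y is NOT η-near a relaxed layered set} − C (L+1)²
   ≤ Σ_{y ∈ X ∩ B̄_L(ctr)} Σ'_{z ∈ X, z ≠ y} V_LJ(|y − z|) − 2 e⋆ · #(X ∩ B̄_L(ctr))` for all `ctr, L`
  (`e⋆ = ⨅_{Q periodic} e(Q)`), given K4. A LOCAL energy–strain inequality on the 1/20-tube (no hull, no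
  ground states); constants may depend on `X`. This is where uniform polytype stability enters.
* `stub_pigeonhole` (M) — a relatively dense `δ`-separated `X` whose `(R, η)`-bad points have density
  zero uniformly on balls, for every `(R, η)`, has near-layered patches at every scale (counting: a
  relatively dense set has `≥ c L³` points in `B̄_L`, so some point is good; translate it to the origin).
* `stub_uniformSpacing` (M) — one spacing for all scales (compactness of `[47/50,1]` + dilation
  covariance; pattern `hb_window_rescale` / `hb_exists_global_spacing`).
* `stub_transfer` (M) — patches of a hull element are windows of the sequence (pattern
  `stub_windowsOfTemplateHullPoint`).
Sorry-free glue proved here: `density_of_price` (the price inequality + the PROVED bulk optimality of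
hull elements `hullBulkOptimal_proof` (12090) + `crysEnergyLimit_proof` (0626: `liminf E(N)/N = e⋆`) give
density zero of bad points, via the landed real bookkeeping `hullDefectDensityZero_bookkeeping` (12091));
`stub_patches` (the birth stub, now DERIVED: price → density → pigeonhole); `BarlowLiouville_of` (the crux
BY NAME).
-/

noncomputable section

namespace Summit.AtomisticToContinuum.Crystallization.Theorems.DisclinationRationBarlowLiouville

open Literature.MathematicalPhysics.StatisticalMechanics Literature.Geometry.DiscreteGeometry
open Summit.AtomisticToContinuum.Crystallization.Theses.DisclinationRation (UniformPolytypeStability)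

/-- Euclidean `3`-space. -/
local notation "E3" => EuclideanSpace ℝ (Fin 3)

/-! ### Registered stubs (signatures in the crux's own vocabulary) -/

/-- STUB C (XL, load-bearing, the lead's) — THE KERNEL AS A SITEWISE CERTIFICATE WITH TRANSFER (rev 6).
For a `δ`-separated, relatively dense, everywhere `1/20`-{fcc,hcp}-good, Barlow-templated `X ⊆ ℝ³` and every
tolerance `ς > 0` there is a charge `κ > 0` such that for every slack `θ > 0` there are a domination constant `M`
and an ANTISYMMETRIC TRANSFER `τ : ℝ³ → ℝ³ → ℝ` with `|τ y z| ≤ M · dist(y,z)⁻⁶` on `X`, such that at EVERY site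
`y ∈ X` the calibrated site excess `h_X(y) − 2e⋆ − Σ'_{z ∈ X, z ≠ y} τ y z` is `≥ −θ`, and `≥ κ − θ` whenever the
open radius-`2` cell of `X` at `y` is `ς`-bad (`h_X(y) = Σ'_{z ∈ X, z ≠ y} V_LJ(dist y z)`,
`e⋆ = ⨅_{Q periodic} e_LJ(Q)`). This is the discrete null-Lagrangian / calibrated sub-action form of the tube
price inequality (cards `calibrated-subaction-excess-density`, `octet-null-lagrangian`; the sibling engine
`PhononSlackNearFieldConvexity` (crux 13958) reduces to the same shape, `CERT_I`): the transfer `τ` absorbs the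
first-order (stress-flux) part of the site excess, which has no sign; only its boundary flux survives summation
(`stub_fluxBookkeeping`). Given K4 (harmonic core). Summing it over `X ∩ B̄_L(ctr)` gives `stub_priceSlack`
(`priceSlack_of_certificate_flux`). -/
theorem stub_siteCertificate :
    UniformPolytypeStability →
    ∀ δ : ℝ, 0 < δ → ∀ X : Set E3, (∀ y ∈ X, ∀ z ∈ X, y ≠ z → δ ≤ dist y z) →
    (∃ R₁ : ℝ, ∀ p : E3, ∃ y ∈ X, dist y p ≤ R₁) →
    (∀ y ∈ X, (let d : ℝ := sInf ((fun z => dist z y) '' (X \ {y}))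
      let T : Set E3 := {z : E3 | z ∈ X ∧ z ≠ y ∧ dist z y < 13 / 10 * d}
      ∃ A : E3 →ₗᵢ[ℝ] E3,
        (∃ e : ↥T ≃ ↥fccKissingPattern, ∀ t : ↥T,
          dist (d⁻¹ • ((t : E3) - y)) (A ((e t : ↥fccKissingPattern) : E3)) ≤ 1 / 20) ∨
        (∃ e : ↥T ≃ ↥hcpKissingPattern, ∀ t : ↥T,
          dist (d⁻¹ • ((t : E3) - y)) (A ((e t : ↥hcpKissingPattern) : E3)) ≤ 1 / 20))) →
    (∃ s : ℤ → ℤ, IsHaggSeq s ∧ ∃ Φ : E3 → E3,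
      Set.BijOn Φ (barlowStacking 1 (Real.sqrt (2 / 3)) s) X ∧
      ∀ p ∈ barlowStacking 1 (Real.sqrt (2 / 3)) s, ∃ A : E3 →ₗᵢ[ℝ] E3, ∃ l : ℝ, 0 < l ∧
        ∀ q ∈ barlowStacking 1 (Real.sqrt (2 / 3)) s, dist q p ≤ 1 →
          dist (Φ q) (Φ p + l • A (q - p)) ≤ 1 / 20 * l) →
    ∀ ς : ℝ, 0 < ς → ∃ κ : ℝ, 0 < κ ∧ ∀ θ : ℝ, 0 < θ → ∃ (M : ℝ) (τ : E3 → E3 → ℝ),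
      (∀ y z : E3, τ y z = -τ z y) ∧
      (∀ y ∈ X, ∀ z ∈ X, y ≠ z → |τ y z| ≤ M * (dist y z)⁻¹ ^ 6) ∧
      (∀ y ∈ X, -θ ≤ (∑' z : ↥{z : E3 | z ∈ X ∧ z ≠ y}, lennardJones (dist y (z : E3)))
            - 2 * (⨅ Q : PeriodicConfiguration 3, Q.energyPerParticle lennardJones)
            - ∑' z : ↥{z : E3 | z ∈ X ∧ z ≠ y}, τ y (z : E3)) ∧
      (∀ y ∈ X, ¬ (∃ a : ℝ, 47 / 50 ≤ a ∧ a ≤ 1 ∧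
            ∃ (A : E3 →ₗᵢ[ℝ] E3) (s : ℤ → ℤ) (z : ℤ → ℝ), IsHaggSeq s ∧
              (∀ m : ℤ, 39 / 50 * a ≤ z (m + 1) - z m ∧ z (m + 1) - z m ≤ 17 / 20 * a) ∧
              let S : Set E3 := {p | ∃ m i j : ℤ, p = A (((i : ℝ) • triangularVec₁ a) +
                ((j : ℝ) • triangularVec₂ a) + ((haggLabel s m : ℝ) • barlowOffset a) +
                (z m • layerNormal 1))}
              (∀ p ∈ S, ‖p‖ < 2 → ∃ q ∈ X, dist (q - y) p ≤ ς) ∧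
              (∀ q ∈ X, ‖q - y‖ < 2 → ∃ p ∈ S, dist (q - y) p ≤ ς)) →
          κ - θ ≤ (∑' z : ↥{z : E3 | z ∈ X ∧ z ≠ y}, lennardJones (dist y (z : E3)))
            - 2 * (⨅ Q : PeriodicConfiguration 3, Q.energyPerParticle lennardJones)
            - ∑' z : ↥{z : E3 | z ∈ X ∧ z ≠ y}, τ y (z : E3)) := by
  sorry

/-! STUB F `stub_fluxBookkeeping` (M) is LANDED: `DisclinationRationBarlowLiouvilleStubFluxBookkeeping.lean` (p172925),
same namespace, imported above. -/

/-! The glue `priceSlack_of_certificate_flux` (certificate + flux ⇒ price with slack) is LANDED: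
`DisclinationRationBarlowLiouvilleCertificateGlue.lean` (p172614), imported above. -/

/-- STUB K `stub_priceSlack` (the rev-4 kernel: TUBE PRICE INEQUALITY AT CELL SCALE WITH MESOSCOPIC SLACK), now
DERIVED (sorry-free here) from the sitewise certificate `stub_siteCertificate` and the flux bookkeeping
`stub_fluxBookkeeping` by `priceSlack_of_certificate_flux`. Statement unchanged (registered rev 4b): for a
`δ`-separated, relatively dense, everywhere `1/20`-good, Barlow-templated `X` and every `ς > 0` there is `c > 0`
such that for every `θ > 0` there is `C` with
`c · #{y ∈ X ∩ B̄_L(ctr) : ¬ CellGood ς X y} − C (L+1)² − θ · #(X ∩ B̄_L(ctr)) ≤ Σ_{y ∈ X ∩ B̄_L(ctr)} h_X(y) − 2 e⋆ #(X ∩ B̄_L(ctr))`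
on every closed ball. Given K4. -/
theorem stub_priceSlack :
    UniformPolytypeStability →
    ∀ δ : ℝ, 0 < δ → ∀ X : Set E3, (∀ y ∈ X, ∀ z ∈ X, y ≠ z → δ ≤ dist y z) →
    (∃ R₁ : ℝ, ∀ p : E3, ∃ y ∈ X, dist y p ≤ R₁) →
    (∀ y ∈ X, (let d : ℝ := sInf ((fun z => dist z y) '' (X \ {y}))
      let T : Set E3 := {z : E3 | z ∈ X ∧ z ≠ y ∧ dist z y < 13 / 10 * d}
      ∃ A : E3 →ₗᵢ[ℝ] E3,
        (∃ e : ↥T ≃ ↥fccKissingPattern, ∀ t : ↥T,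
          dist (d⁻¹ • ((t : E3) - y)) (A ((e t : ↥fccKissingPattern) : E3)) ≤ 1 / 20) ∨
        (∃ e : ↥T ≃ ↥hcpKissingPattern, ∀ t : ↥T,
          dist (d⁻¹ • ((t : E3) - y)) (A ((e t : ↥hcpKissingPattern) : E3)) ≤ 1 / 20))) →
    (∃ s : ℤ → ℤ, IsHaggSeq s ∧ ∃ Φ : E3 → E3,
      Set.BijOn Φ (barlowStacking 1 (Real.sqrt (2 / 3)) s) X ∧
      ∀ p ∈ barlowStacking 1 (Real.sqrt (2 / 3)) s, ∃ A : E3 →ₗᵢ[ℝ] E3, ∃ l : ℝ, 0 < l ∧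
        ∀ q ∈ barlowStacking 1 (Real.sqrt (2 / 3)) s, dist q p ≤ 1 →
          dist (Φ q) (Φ p + l • A (q - p)) ≤ 1 / 20 * l) →
    ∀ ς : ℝ, 0 < ς → ∃ c : ℝ, 0 < c ∧ ∀ θ : ℝ, 0 < θ → ∃ C : ℝ, ∀ (ctr : E3) (L : ℝ),
      c * (({y : E3 | y ∈ X ∧ dist y ctr ≤ L ∧ ¬ (∃ a : ℝ, 47 / 50 ≤ a ∧ a ≤ 1 ∧
            ∃ (A : E3 →ₗᵢ[ℝ] E3) (s : ℤ → ℤ) (z : ℤ → ℝ), IsHaggSeq s ∧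
              (∀ m : ℤ, 39 / 50 * a ≤ z (m + 1) - z m ∧ z (m + 1) - z m ≤ 17 / 20 * a) ∧
              let S : Set E3 := {p | ∃ m i j : ℤ, p = A (((i : ℝ) • triangularVec₁ a) +
                ((j : ℝ) • triangularVec₂ a) + ((haggLabel s m : ℝ) • barlowOffset a) +
                (z m • layerNormal 1))}
              (∀ p ∈ S, ‖p‖ < 2 → ∃ q ∈ X, dist (q - y) p ≤ ς) ∧
              (∀ q ∈ X, ‖q - y‖ < 2 → ∃ p ∈ S, dist (q - y) p ≤ ς))} : Set E3).ncard : ℝ)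
        - C * (L + 1) ^ 2 - θ * (({y : E3 | y ∈ X ∧ dist y ctr ≤ L} : Set E3).ncard : ℝ) ≤
      (∑' y : ↥{y : E3 | y ∈ X ∧ dist y ctr ≤ L},
          ∑' z : ↥{z : E3 | z ∈ X ∧ z ≠ (y : E3)}, lennardJones (dist (y : E3) (z : E3)))
        - 2 * (⨅ Q : PeriodicConfiguration 3, Q.energyPerParticle lennardJones)
            * (({y : E3 | y ∈ X ∧ dist y ctr ≤ L} : Set E3).ncard : ℝ) := by
  intro hK δ hδ X hsep hdense hgood htemp ς hς
  obtain ⟨κ, hκ, hcert⟩ := stub_siteCertificate hK δ hδ X hsep hdense hgood htemp ς hς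
  refine ⟨κ, hκ, fun θ hθ => ?_⟩
  obtain ⟨M, τ, hanti, hdom, hall, hbad⟩ := hcert θ hθ
  obtain ⟨C, hC⟩ := stub_fluxBookkeeping δ hδ X hsep M τ hanti hdom
  refine ⟨C, fun ctr L => ?_⟩
  exact priceSlack_of_certificate_flux hδ hsep _
    (fun y => ∑' z : ↥{z : E3 | z ∈ X ∧ z ≠ y}, lennardJones (dist y (z : E3)))
    (fun y => ∑' z : ↥{z : E3 | z ∈ X ∧ z ≠ y}, τ y (z : E3))
    (⨅ Q : PeriodicConfiguration 3, Q.energyPerParticle lennardJones) κ θ C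
    (fun y hy => by linarith [hall y hy]) (fun y hy hb => by linarith [hbad y hy hb]) hC ctr L

/-! STUB G `stub_cellsToPatches` (M/L) is LANDED: `DisclinationRationBarlowLiouvilleStubCellsToPatches{,1,2}.lean`,
same namespace, imported above (via the landed global exact rigidity `PrestressSplitKorn.exactLayeredRigidity_holds`). -/

/-! STUB P `stub_pigeonhole` (M) is LANDED: `DisclinationRationBarlowLiouvilleStubPigeonhole.lean` (p166435;
import fix p167739), same namespace, imported above. -/

/-! STUB 2 `stub_uniformSpacing` (M) is LANDED: `DisclinationRationBarlowLiouvilleStubUniformSpacing.lean`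
(p166424), same namespace, imported above. -/

/-! STUB 3 `stub_transfer` (M) is LANDED: `DisclinationRationBarlowLiouvilleStubTransfer.lean` (p166111),
same namespace, imported above. -/

/-! ### Sorry-free glue -/

/-- `liminf_N E(N)/N ≤ e⋆ = ⨅_{Q periodic} e(Q)` — from the landed `crysEnergyLimit_proof` (item 0626:
`E(N)/N → e⋆`). -/
theorem liminf_groundStateEnergy_div_le_iInf :
    Filter.liminf (fun N : ℕ => groundStateEnergy lennardJones 3 N / (N : ℝ)) Filter.atTop ≤
      ⨅ Q : PeriodicConfiguration 3, Q.energyPerParticle lennardJones := by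
  have h := crysEnergyLimit_proof
  unfold Summit.AtomisticToContinuum.Crystallization.Theses.ExcessDecayLiouville.CrysEnergyLimit at h
  exact le_of_eq h.liminf_eq

/-- THE BIRTH STUB `stub_patches`, DERIVED (sorry-free here): near-layered patches at every scale in a templated,
everywhere-good, relatively dense, `δ`-separated hull element `X` of Lennard-Jones ground states, given K4 — from the
kernel with slack (`stub_priceSlack`), cells → patches (`stub_cellsToPatches` + the landed slack transfer
`slack_transfer`), the landed bulk optimality of hull elements (`hullBulkOptimal_proof`, item 12090),
`liminf E(N)/N ≤ e⋆` (item 0626), the slack bookkeeping `density_of_priceSlack` (with the packing bound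
`ncard_ball_le_cube`) and the landed counting stub `stub_pigeonhole`. -/
theorem stub_patches :
    UniformPolytypeStability →
    ∀ x : (N : ℕ) → (Fin N → E3), (∀ N, IsGroundState lennardJones (x N)) →
    ∀ δ : ℝ, 0 < δ → ∀ X : Set E3, (∀ y ∈ X, ∀ z ∈ X, y ≠ z → δ ≤ dist y z) →
    (∃ φ : ℕ → ℕ, StrictMono φ ∧ ∃ τ : ℕ → E3, ∀ R ε : ℝ, 0 < ε → ∀ᶠ j : ℕ in Filter.atTop,
      (∀ s ∈ X, ‖s‖ ≤ R → ∃ i : Fin (φ j), dist (x (φ j) i + τ j) s ≤ ε) ∧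
      (∀ i : Fin (φ j), ‖x (φ j) i + τ j‖ ≤ R → ∃ s ∈ X, dist (x (φ j) i + τ j) s ≤ ε)) →
    (∃ R₁ : ℝ, ∀ p : E3, ∃ y ∈ X, dist y p ≤ R₁) →
    (∀ y ∈ X, (let d : ℝ := sInf ((fun z => dist z y) '' (X \ {y}))
      let T : Set E3 := {z : E3 | z ∈ X ∧ z ≠ y ∧ dist z y < 13 / 10 * d}
      ∃ A : E3 →ₗᵢ[ℝ] E3,
        (∃ e : ↥T ≃ ↥fccKissingPattern, ∀ t : ↥T,
          dist (d⁻¹ • ((t : E3) - y)) (A ((e t : ↥fccKissingPattern) : E3)) ≤ 1 / 20) ∨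
        (∃ e : ↥T ≃ ↥hcpKissingPattern, ∀ t : ↥T,
          dist (d⁻¹ • ((t : E3) - y)) (A ((e t : ↥hcpKissingPattern) : E3)) ≤ 1 / 20))) →
    (∃ s : ℤ → ℤ, IsHaggSeq s ∧ ∃ Φ : E3 → E3,
      Set.BijOn Φ (barlowStacking 1 (Real.sqrt (2 / 3)) s) X ∧
      ∀ p ∈ barlowStacking 1 (Real.sqrt (2 / 3)) s, ∃ A : E3 →ₗᵢ[ℝ] E3, ∃ l : ℝ, 0 < l ∧
        ∀ q ∈ barlowStacking 1 (Real.sqrt (2 / 3)) s, dist q p ≤ 1 →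
          dist (Φ q) (Φ p + l • A (q - p)) ≤ 1 / 20 * l) →
    ∀ R η : ℝ, 0 < η → ∃ a : ℝ, 47 / 50 ≤ a ∧ a ≤ 1 ∧
      ∃ (A : E3 →ₗᵢ[ℝ] E3) (t : E3) (s : ℤ → ℤ) (z : ℤ → ℝ), IsHaggSeq s ∧
        (∀ m : ℤ, 39 / 50 * a ≤ z (m + 1) - z m ∧ z (m + 1) - z m ≤ 17 / 20 * a) ∧
        let S : Set E3 := {p | ∃ m i j : ℤ, p = A (((i : ℝ) • triangularVec₁ a) +
          ((j : ℝ) • triangularVec₂ a) + ((haggLabel s m : ℝ) • barlowOffset a) + (z m • layerNormal 1))}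
        (∀ p ∈ S, ‖p‖ ≤ R → ∃ q ∈ X, dist (q + t) p ≤ η) ∧
        (∀ q ∈ X, ‖q + t‖ ≤ R → ∃ p ∈ S, dist (q + t) p ≤ η) := by
  intro hK x hx δ hδ X hsep hhull hdense hgood htemp
  -- bulk optimality of the hull element (item 12090, landed)
  have hE := hullBulkOptimal_proof x hx X δ hδ hsep hhull
  refine stub_pigeonhole δ hδ X hsep hdense (fun R η hη => ?_)
  -- cells → patches for this (R, η), then the kernel at tolerance ς, transferred with slack
  obtain ⟨ς, hς, r, hr, hcp⟩ := stub_cellsToPatches δ hδ R η hη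
  have hP := slack_transfer hδ hsep hr
    (exc := fun ctr L => (∑' y : ↥{y : E3 | y ∈ X ∧ dist y ctr ≤ L},
          ∑' z : ↥{z : E3 | z ∈ X ∧ z ≠ (y : E3)}, lennardJones (dist (y : E3) (z : E3)))
        - 2 * (⨅ Q : PeriodicConfiguration 3, Q.energyPerParticle lennardJones)
            * (({y : E3 | y ∈ X ∧ dist y ctr ≤ L} : Set E3).ncard : ℝ))
    (n := fun ctr L => (({y : E3 | y ∈ X ∧ dist y ctr ≤ L} : Set E3).ncard : ℝ))
    (hcp X hsep) (stub_priceSlack hK δ hδ X hsep hdense hgood htemp ς hς)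
  exact density_of_priceSlack (V := E3) _ (fun ctr L => (({y : E3 | y ∈ X ∧ dist y ctr ≤ L} : Set E3).ncard : ℝ))
    (fun ctr L => (∑' y : ↥{y : E3 | y ∈ X ∧ dist y ctr ≤ L},
          ∑' z : ↥{z : E3 | z ∈ X ∧ z ≠ (y : E3)}, lennardJones (dist (y : E3) (z : E3))))
    _ _ ((2 / δ + 1) ^ 3) (fun _ _ => Nat.cast_nonneg _)
    (fun ctr L hL => ncard_ball_le_cube hδ hsep ctr hL) (by positivity)
    liminf_groundStateEnergy_div_le_iInf hP hE

/-- THE SKELETON THEOREM: the crux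
`Summit.AtomisticToContinuum.Crystallization.Theses.DisclinationRation.BarlowLiouville` concluded BY
NAME from the declared stubs; the crux's inlined `let GF / let HL / let S` clauses agree with the
stub signatures by definitional (zeta/beta) unfolding. -/
theorem BarlowLiouville_of :
    Summit.AtomisticToContinuum.Crystallization.Theses.DisclinationRation.BarlowLiouville := by
  intro hK GF HL x hx δ hδ X hsep hhull hdense hgood htemp
  exact stub_transfer x X hhull
    (stub_uniformSpacing X (stub_patches hK x hx δ hδ X hsep hhull hdense hgood htemp))

end Summit.AtomisticToContinuum.Crystallization.Theorems.DisclinationRationBarlowLiouville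

end
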